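import Summits.NavierStokesRegularity.NavierStokesRegularity.Theorems.TargetDepletionLadderPalinstrophyIdentityC1
import Summits.NavierStokesRegularity.NavierStokesRegularity.Theorems.TypeICertificateLadderTargetDepletionAlignmentIdentity
import HarnessLib

/-!
# Crux `Target` (stmt-NavierStokesRegularity-1217), line `depletion_ladder`, stub S1: the alignment laws
# `R² + D ≤ 1`, `R² + A ≤ 1`, `R² + Q ≤ 1` on the EXACT registered class (`u ∈ C²`)

`--supports stmt-NavierStokesRegularity-1217` (seat leafhand-ns-poloidalwindowdoor-2 g1, cell decomp-ns;
sequel of `…TargetDepletionLadderPalinstrophyIdentityC1`, p817198).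

The "structure of near-extremisers" laws of the STA lineage (`…TargetDepletionAlignmentIdentity`:
`sq_integral_stretching_add_defect_le`, `sq_integral_stretching_add_direction_defect_le`) are stated in
S1's normalisation `M‖ω‖₂‖∇ω‖₂` only for `u ∈ C³`, because the conversion `‖curl ω‖₂ = ‖∇ω‖₂` was
available only there; the un-normalised laws (`…TargetDepletionAlignmentDefect`) already live on the
registered class `u ∈ C²`. With the `C¹` palinstrophy identity
`C1DivCurl.integral_norm_curl_curl_sq_eq_of_contDiff_two` (p817198) the normalised laws hold on the
EXACT class of the registered `def StretchingDepletion` (`u ∈ C²` divergence free, `|u| ≤ M`,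
`ω = curl u ∈ L²`, `|∇ω|_F ∈ L²`, integrable stretching density; no decay of `u`):

* `sq_integral_stretching_add_defect_le_of_contDiff_two` — `J² + ‖ω‖₂²·‖⟪u, curl ω⟫‖₂² ≤ M²‖ω‖₂²‖∇ω‖₂²`
  (`R² + D ≤ 1`);
* `sq_integral_stretching_add_direction_defect_le_of_contDiff_two` —
  `J² + M²‖ω‖₂² ∫⟪u, curl ω⟫²/‖u‖² ≤ M²‖ω‖₂²‖∇ω‖₂²` (`R² + A ≤ 1`);
* `sq_integral_stretching_add_concentration_le_of_contDiff_two` — finite energy: `R² + Q ≤ 1` with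
  `Q = ‖ω‖₂⁴/(‖u‖₂²‖∇ω‖₂²)` in S1's normalisation.

HONEST LABEL: bookkeeping corollaries (regularity lowered from `C³` to the registered `C²`); no bound
`κ < 1`; closes no stub; `Target`, S3 and NS regularity remain OPEN. [folklore]
-/

noncomputable section

-- the summit and its single sub-problem share the name (CONVENTIONS §1)
set_option linter.dupNamespace false

open Set Filter Topology MeasureTheory
open scoped RealInnerProductSpace
open Literature.Analysis.FluidPDE

namespace Summit.NavierStokesRegularity.NavierStokesRegularity.Theorems.DepletionLadder.C1DivCurl

variable {u : EuclideanSpace ℝ (Fin 3) → EuclideanSpace ℝ (Fin 3)} {M : ℝ}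

/-- **`R² + D ≤ 1` on the registered class.** For `u ∈ C²(ℝ³; ℝ³)` divergence free, `|u| ≤ M`,
`ω = curl u ∈ L²`, `|∇ω|_F ∈ L²`, integrable stretching density:
`(∫⟪ω, Du ω⟫)² + ‖ω‖₂² · ∫⟪u, curl ω⟫² ≤ M² ‖ω‖₂² ‖∇ω‖₂²`. [folklore] -/
theorem sq_integral_stretching_add_defect_le_of_contDiff_two (hu : ContDiff ℝ 2 u)
    (hdiv : VectorCalculus.IsDivFree u) (hM : ∀ x, ‖u x‖ ≤ M)
    (iZ : Integrable (fun x => ‖curl u x‖ ^ 2))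
    (iA : Integrable (fun x => frobeniusNormSq (fderiv ℝ (curl u) x)))
    (iJ : Integrable (fun x => ⟪curl u x, fderiv ℝ u x (curl u x)⟫)) :
    (∫ x, ⟪curl u x, fderiv ℝ u x (curl u x)⟫) ^ 2 +
        (∫ x, ‖curl u x‖ ^ 2) * ∫ x, ⟪u x, curl (curl u) x⟫ ^ 2 ≤
      M ^ 2 * (∫ x, ‖curl u x‖ ^ 2) * ∫ x, frobeniusNormSq (fderiv ℝ (curl u) x) := by
  have h := sq_integral_stretching_le_defect hu hdiv hM iZ iA iJ
  rw [integral_norm_curl_curl_sq_eq_of_contDiff_two hu iZ iA] at h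
  linarith

/-- **`R² + A ≤ 1` on the registered class** (`u ∈ C²`, same binders):
`(∫⟪ω, Du ω⟫)² + M²‖ω‖₂² ∫⟪u, curl ω⟫²/‖u‖² ≤ M² ‖ω‖₂² ‖∇ω‖₂²`. [folklore] -/
theorem sq_integral_stretching_add_direction_defect_le_of_contDiff_two (hu : ContDiff ℝ 2 u)
    (hdiv : VectorCalculus.IsDivFree u) (hM : ∀ x, ‖u x‖ ≤ M)
    (iZ : Integrable (fun x => ‖curl u x‖ ^ 2))
    (iA : Integrable (fun x => frobeniusNormSq (fderiv ℝ (curl u) x)))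
    (iJ : Integrable (fun x => ⟪curl u x, fderiv ℝ u x (curl u x)⟫)) :
    (∫ x, ⟪curl u x, fderiv ℝ u x (curl u x)⟫) ^ 2 +
        M ^ 2 * (∫ x, ‖curl u x‖ ^ 2) * ∫ x, ⟪u x, curl (curl u) x⟫ ^ 2 / ‖u x‖ ^ 2 ≤
      M ^ 2 * (∫ x, ‖curl u x‖ ^ 2) * ∫ x, frobeniusNormSq (fderiv ℝ (curl u) x) := by
  have h := sq_integral_stretching_le_direction_defect hu hdiv hM iZ iA iJ
  rw [integral_norm_curl_curl_sq_eq_of_contDiff_two hu iZ iA] at h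
  linarith

/-- **`R² + Q ≤ 1` in S1's normalisation on the registered class with finite energy** (`u ∈ C² ∩ L²`,
same binders): `(∫⟪ω, Du ω⟫)² + M²‖ω‖₂² · ‖ω‖₂⁴/‖u‖₂² ≤ M² ‖ω‖₂² ‖∇ω‖₂²`
(the tree's `sq_integral_stretching_add_concentration_le`, with `‖curl ω‖₂²` converted to `‖∇ω‖₂²`).
[folklore] -/
theorem sq_integral_stretching_add_concentration_le_of_contDiff_two (hu : ContDiff ℝ 2 u)
    (hdiv : VectorCalculus.IsDivFree u) (hM : ∀ x, ‖u x‖ ≤ M)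
    (iE : Integrable (fun x => ‖u x‖ ^ 2))
    (iZ : Integrable (fun x => ‖curl u x‖ ^ 2))
    (iA : Integrable (fun x => frobeniusNormSq (fderiv ℝ (curl u) x)))
    (iJ : Integrable (fun x => ⟪curl u x, fderiv ℝ u x (curl u x)⟫)) :
    (∫ x, ⟪curl u x, fderiv ℝ u x (curl u x)⟫) ^ 2 +
        M ^ 2 * (∫ x, ‖curl u x‖ ^ 2) * ((∫ x, ‖curl u x‖ ^ 2) ^ 2 / ∫ x, ‖u x‖ ^ 2) ≤
      M ^ 2 * (∫ x, ‖curl u x‖ ^ 2) * ∫ x, frobeniusNormSq (fderiv ℝ (curl u) x) := by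
  have h := sq_integral_stretching_add_concentration_le hu hdiv hM iE iZ iA iJ
  rw [integral_norm_curl_curl_sq_eq_of_contDiff_two hu iZ iA] at h
  exact h

end Summit.NavierStokesRegularity.NavierStokesRegularity.Theorems.DepletionLadder.C1DivCurl

end
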